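/-
Copyright (c) 2026. All rights reserved.
Released under Apache 2.0 license as described in the file LICENSE.
-/
import Literature.Computability.QuantumComplexity.GRBlockWordCosFP
import Literature.Computability.QuantumComplexity.GRWlenFP

/-!
# The table sampler's Grover–Rudolph block word on codes from `ℓ, np, k+1` in unary

Corollary of `GRBlockWordCosFP.blockAN_cos_codeFP_of` and `GRWlenFP.wlen_codeFP_of`: the abstract gate word of
`GRStage.blockCircuit (GRTableMach.data τ S p U k ℓ np hnp)` (by `GRTableMach.map_toAG_blockCircuit_data` it is
`GRStage.blockAN (cosE τ) (cosM τ) ℓ np (wlen τ ℓ np) (k+1) (GRCosineMach.v np)`) is on codes from a context giving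
ONLY `ℓ`, `np` and `k+1` in unary — the window length `wlen` is computed.  This is stage S3 of the uniformity of
the machine sampler, up to its placement in the stage and reading the three sizes off the parameter word.
[cite: Regev2009, Lemma 3.12 (proof), Lemma 3.14 (proof)] [cite: AroraBarak2009, §6.2 (proof of Thm. 6.15)]
[cite: GroverRudolph2002, eq. (5)]

HONEST FRAMING: the VALUE is a THEOREM (kernel-checked lemmas of a KNOWN reduction, Regev 2009) — NOT summit progress.
-/

noncomputable section

namespace Literature.Computability.QuantumComplexity

open _root_.Computability Cryptography Complexity Complexity.CodeFP SLP RevDesc AJLCore RevSim RevClean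

namespace GRTableMach

variable {σ : Type} {eσ : σ → List Bool}

/-- **The table sampler's block word on codes from `ℓ, np, k+1` in unary.** [cite: Regev2009, Lemma 3.14 (proof)]
[cite: AroraBarak2009, §6.2 (proof of Thm. 6.15)] -/
theorem blockAN_codeFP_of (τ : LevelCode) {ℓ np kk : σ → ℕ} (hℓ : CodeFP eσ unE ℓ) (hnp : CodeFP eσ unE np)
    (hk : CodeFP eσ unE kk) : CodeFP eσ (rawE agE0) (fun c =>
      GRStage.blockAN (cosE τ) (cosM τ) (ℓ c) (np c) (wlen τ (ℓ c) (np c)) (kk c) (GRCosineMach.v (np c))) :=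
  GRStage.blockAN_cos_codeFP_of (cosE τ) (cosM τ) hℓ hnp (wlen_codeFP_of τ hℓ hnp) hk

/-- **The block circuit of the table sampler's data abstracts to a word on codes**: for `ℓ, np, k+1` read off a
context in unary, `c ↦ (GRStage.blockCircuit (data τ S p U k (ℓ c) (np c) _)).gates.map toAG` is in FP whenever
`kk c = k + 1` and the parameter code fits (`hnp`). [cite: Regev2009, Lemma 3.14 (proof)]
[cite: AroraBarak2009, §6.2 (proof of Thm. 6.15)] -/
theorem map_toAG_blockCircuit_codeFP_of (τ : LevelCode) (S : ℚ) (p U k : ℕ) {ℓ np : σ → ℕ}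
    (hℓ : CodeFP eσ unE ℓ) (hnp : CodeFP eσ unE np)
    (hfit : ∀ c, (GRCosineMach.pcode ((S, (p, U)), (k, ℓ c))).length ≤ np c) :
    CodeFP eσ (rawE agE0) (fun c => (GRStage.blockCircuit
      (kit := GenKit.kit (GRData.ps (k + 1)) (ℓ c + np c + wlen τ (ℓ c) (np c)) (k + 1))
      (data τ S p U k (ℓ c) (np c) (hfit c))).gates.map toAG) :=
  (blockAN_codeFP_of τ (kk := fun _ => k + 1) hℓ hnp (const _ (k + 1))).congr fun c =>
    (map_toAG_blockCircuit_data τ S p U k (ℓ c) (np c) (hfit c)).symm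

end GRTableMach

end Literature.Computability.QuantumComplexity

end
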